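import Literature.AlgebraicGeometry.GroupSchemes.KernelIdealSpecialFibre
import Mathlib.RingTheory.Flat.Equalizer
import HarnessLib

/-!
# IMAGES SPECIALISE: the special fibre of the schematic closure of the generic image of a homomorphism contains — and under a flat
# cokernel equals — the special image ([EGAIV2] Prop. 2.8.5; [Tate1997FiniteFlatGroupSchemes] (3.7); [GortzWedhorn2023] §(27.2))

Topic `Literature/AlgebraicGeometry/GroupSchemes`; namespace `Literature.AlgebraicGeometry.GroupSchemes.AffineGroupScheme`.  THEOREMS ONLY (no
definition, no instance, no notation, no named fact, no `sorry`).  Cell `hodgecm-mathlib` (D-0151), programme P6 «MOD» (crux hLiu418 =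
stmt-HodgeConjecture-24832, `--supports`, count-neutral): organ **(O-K′) ∕ (SP-img) «IMAGES SPECIALISE»** of the D-line `stub_DOWN` payer, line L2,
KERNEL-IDEAL SPECIALISATION road (LEAD F0P6-plan (g3) `LDEAL-L1-L7.v1` §L2; census `F0/P6/B-p08/g34/MEMO-stubDOWN-census.v1.B-p08g34.md` row
`QuotQuot₀Law`): the IMAGE twin of ★ (O-K) `KernelIdealSpecialFibre` (`map_ker_counit_pullback_le_spI` ∕ `spI_map_ker_counit_pullback_eq`).  The
D6 kills-form law `QuotQuot₀Law` reads its hypothesis «`H′ ≤ ker Γ(isogW₀ x̄ H)`» as «`V(H′)` contains the image of the layer map»; to identify `H′`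
with the specialisation `sp y′ L_b` of the upstairs backtracking ∕ image line one needs `sp y′ L_b ≤ ker Γ(isogW₀ x̄ H)`, i.e. — in the Hopf-ideal
currency of ★ `AdmissibleIdealSpecialFibre` (`spI`) — `spI (ker Γ(φ_K)) ≤ ker Γ(φ_κ)` for the layer map `φ` over the valuation ring (§2), after which
the corank count (line L2 organ (D6-rk), LA2-p01) or the flat-cokernel equality (§3) pins `H′`.  HC_CM is proved only modulo the printed citations until
rung 0 closes; this file is generic and changes no count.

THE MATHEMATICS.  `φ : G₁ → G₂` a morphism of affine schemes over a commutative ring `R` (group structures are carried as the ★ base-change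
files carry them, but play no role); `Γ(φ) : Γ(G₂) → Γ(G₁)`; for an `R`-algebra `S`, `φ_S` the base change and `e_S : Γ(G_S) ≅ S ⊗_R Γ(G)` (★
`algBaseChangeEquiv`, natural in `G`: ★ `algBaseChangeEquiv_comap_pullback_map`).  The schematic image of `φ_S` is `V(ker Γ(φ_S))`, and `ker Γ(φ_S) =
e_S⁻¹ (ker (S ⊗ Γ(φ)))`.  (§1) Along `includeRight : Γ(G₂) → K ⊗_R Γ(G₂)`: `ker Γ(φ) ≤ e_K(ker Γ(φ_K)) ∩ Γ(G₂)` always, and `=` as soon as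
`Γ(G₁) → K ⊗_R Γ(G₁)` is injective (`Γ(G₁)` flat, `R → K` injective; Mathlib `Algebra.TensorProduct.includeRight_injective`) — «the schematic image of
`φ` is the schematic closure of the generic image».  (§2) Hence `spI (ker Γ(φ_K)) = e_κ⁻¹((e_K(ker Γ(φ_K)) ∩ Γ(G₂)) · (κ ⊗ Γ(G₂))) = e_κ⁻¹(ker Γ(φ) ·
(κ ⊗ Γ(G₂))) ≤ e_κ⁻¹(ker (κ ⊗ Γ(φ))) = ker Γ(φ_κ)` (HEAD `spI_ker_comap_pullback_map_le`).  (§3) Conversely, factor `Γ(φ) = g ∘ π` through its image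
`N ⊂ Γ(G₁)`; if the cokernel `Γ(G₁) ⧸ N` is `R`-flat then `κ ⊗ g` is injective (Mathlib `LinearMap.lTensor_injective_of_exact_of_flat`), so `ker (κ ⊗
Γ(φ)) = ker (κ ⊗ π) = im (κ ⊗ ker Γ(φ))` (right exactness, Mathlib `lTensor_exact`, `Ideal.map_includeRight_eq`), whence `ker Γ(φ_κ) ≤ spI (ker
Γ(φ_K))` and EQUALITY (HEAD `spI_ker_comap_pullback_map_eq`).  In the application (`φ` = the `𝔭`-layer of a quotient isogeny `A → A ⧸ 𝓗` over
`𝒪_Ω̄`, `𝓗` finite flat) the cokernel is flat because `A[𝔭] → A[𝔭] ⧸ 𝓗` is faithfully flat; the line uses §2 + the rank count instead.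

* §1 `comap_includeRight_map_algBaseChangeEquiv_ker_le`, `ker_le_comap_includeRight_map_algBaseChangeEquiv_ker`,
  `comap_includeRight_map_algBaseChangeEquiv_ker_eq`;
* §2 HEAD **`spI_ker_comap_pullback_map_le`** (inclusion, `Γ(G₁)` flat, `R → K` injective);
* §3 `lTensor_comap_toLinearMap_apply`, **`ker_comap_pullback_map_le_spI`** (reverse inclusion, flat cokernel), HEAD **`spI_ker_comap_pullback_map_eq`**.

## References
* [EGAIV2] A. Grothendieck, J. Dieudonné, *ÉGA* IV₂, Publ. Math. IHÉS 24 (1965), Prop. 2.8.5.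
* [Tate1997FiniteFlatGroupSchemes] J. Tate, *Finite flat group schemes* (1997), (3.7).
* [GortzWedhorn2023] U. Görtz, T. Wedhorn, *Algebraic Geometry II* (2023), §(27.2) (27.2.1) (pp. 606–607).
* [GortzWedhorn2020] U. Görtz, T. Wedhorn, *Algebraic Geometry I*, 2nd ed. (2020), (4.15), Definition 4.45 (2) (p. 117).
-/

set_option autoImplicit false

set_option backward.isDefEq.respectTransparency false

universe u

open CategoryTheory CategoryTheory.Limits AlgebraicGeometry MonoidalCategory CartesianMonoidalCategory TensorProduct

noncomputable section

namespace Literature.AlgebraicGeometry.GroupSchemes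

namespace AffineGroupScheme

open scoped MonObj CategoryTheory.Obj

open Literature.AlgebraicGeometry.Motives GroupSchemeKernel

variable {R : Type u} [CommRing R] (K κ : Type u) [Field K] [Algebra R K] [Field κ] [Algebra R κ]
  {G₁ G₂ : SchemeOver R} [GrpObj G₁] [GrpObj G₂] [IsAffine G₁.left] [IsAffine G₂.left] (φ : G₁ ⟶ G₂)
  [IsAffine ((Over.pullback (Spec.map (CommRingCat.ofHom (algebraMap R K)))).obj G₁).left]
  [IsAffine ((Over.pullback (Spec.map (CommRingCat.ofHom (algebraMap R κ)))).obj G₁).left]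
  [IsAffine ((Over.pullback (Spec.map (CommRingCat.ofHom (algebraMap R K)))).obj G₂).left]
  [IsAffine ((Over.pullback (Spec.map (CommRingCat.ofHom (algebraMap R κ)))).obj G₂).left]

/-! ## §1 The generic image ideal meets `Γ(G₂)` in the image ideal -/

section GenericImage

omit [IsAffine ((Over.pullback (Spec.map (CommRingCat.ofHom (algebraMap R κ)))).obj G₁).left]
  [IsAffine ((Over.pullback (Spec.map (CommRingCat.ofHom (algebraMap R κ)))).obj G₂).left]

/-- **`(e_K (ker Γ(φ_K))) ∩ Γ(G₂) ≤ ker Γ(φ)`** along `includeRight`, when `Γ(G₁) → K ⊗_R Γ(G₁)` is injective (`Γ(G₁)` flat over `R` and `R → K`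
injective, Mathlib `Algebra.TensorProduct.includeRight_injective`): for `a ∈ Γ(G₂)` with `e_K⁻¹(1 ⊗ a) ∈ ker Γ(φ_K)`, naturality ★
`algBaseChangeEquiv_symm_map_comap` gives `1 ⊗ Γ(φ)(a) = 0` in `K ⊗_R Γ(G₁)`. [cite: EGAIV2, Prop. 2.8.5] [cite: GortzWedhorn2023, §(27.2) (27.2.1) (pp. 606–607)] -/
theorem comap_includeRight_map_algBaseChangeEquiv_ker_le [Module.Flat R (Alg G₁)] (hK : Function.Injective (algebraMap R K)) :
    ((RingHom.ker (Alg.comap ((Over.pullback (Spec.map (CommRingCat.ofHom (algebraMap R K)))).map φ)).toRingHom).map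
        (algBaseChangeEquiv K G₂)).comap (Algebra.TensorProduct.includeRight : Alg G₂ →ₐ[R] K ⊗[R] Alg G₂) ≤
      RingHom.ker (Alg.comap φ).toRingHom := by
  intro a ha
  rw [Ideal.mem_comap, Ideal.mem_map_iff_of_surjective _ (algBaseChangeEquiv K G₂).surjective] at ha
  obtain ⟨x, hx, hxa⟩ := ha
  rw [RingHom.mem_ker] at hx ⊢
  change Alg.comap ((Over.pullback (Spec.map (CommRingCat.ofHom (algebraMap R K)))).map φ) x = 0 at hx
  change Alg.comap φ a = 0
  have hx' : x = (algBaseChangeEquiv K G₂).symm ((1 : K) ⊗ₜ[R] a) := by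
    rw [AlgEquiv.eq_symm_apply, hxa, Algebra.TensorProduct.includeRight_apply]
  rw [hx', ← RingHom.mem_ker] at hx
  have h1 : (algBaseChangeEquiv K G₁).symm (Algebra.TensorProduct.map (AlgHom.id K K) (Alg.comap φ) ((1 : K) ⊗ₜ[R] a)) = 0 := by
    rw [algBaseChangeEquiv_symm_map_comap]
    exact hx
  rw [Algebra.TensorProduct.map_tmul, AlgHom.id_apply, map_eq_zero_iff _ (algBaseChangeEquiv K G₁).symm.injective] at h1
  have hinj : Function.Injective (Algebra.TensorProduct.includeRight : Alg G₁ →ₐ[R] K ⊗[R] Alg G₁) :=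
    Algebra.TensorProduct.includeRight_injective hK
  exact hinj (by rw [Algebra.TensorProduct.includeRight_apply, h1, map_zero])

/-- **`ker Γ(φ) ≤ (e_K (ker Γ(φ_K))) ∩ Γ(G₂)`** along `includeRight` — no hypothesis: `e_K⁻¹(1 ⊗ a)` lies in `ker Γ(φ_K)` because
`Γ(φ_K)(e_K⁻¹(1 ⊗ a)) = e_K⁻¹(1 ⊗ Γ(φ)(a))` (★ `algBaseChangeEquiv_symm_map_comap`). [cite: EGAIV2, Prop. 2.8.5] [cite: GortzWedhorn2023, §(27.2) (27.2.1) (pp. 606–607)] -/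
theorem ker_le_comap_includeRight_map_algBaseChangeEquiv_ker :
    RingHom.ker (Alg.comap φ).toRingHom ≤
      ((RingHom.ker (Alg.comap ((Over.pullback (Spec.map (CommRingCat.ofHom (algebraMap R K)))).map φ)).toRingHom).map
        (algBaseChangeEquiv K G₂)).comap (Algebra.TensorProduct.includeRight : Alg G₂ →ₐ[R] K ⊗[R] Alg G₂) := by
  intro a ha
  rw [RingHom.mem_ker] at ha
  rw [Ideal.mem_comap, Ideal.mem_map_iff_of_surjective _ (algBaseChangeEquiv K G₂).surjective]
  refine ⟨(algBaseChangeEquiv K G₂).symm ((1 : K) ⊗ₜ[R] a), ?_, by rw [AlgEquiv.apply_symm_apply, Algebra.TensorProduct.includeRight_apply]⟩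
  rw [RingHom.mem_ker]
  change Alg.comap ((Over.pullback (Spec.map (CommRingCat.ofHom (algebraMap R K)))).map φ) ((algBaseChangeEquiv K G₂).symm ((1 : K) ⊗ₜ[R] a)) = 0
  rw [← algBaseChangeEquiv_symm_map_comap, Algebra.TensorProduct.map_tmul, AlgHom.id_apply]
  change (algBaseChangeEquiv K G₁).symm ((1 : K) ⊗ₜ[R] (Alg.comap φ).toRingHom a) = 0
  rw [ha, TensorProduct.tmul_zero, map_zero]

/-- **THE SCHEMATIC IMAGE IS THE CLOSURE OF THE GENERIC IMAGE**: `(e_K (ker Γ(φ_K))) ∩ Γ(G₂) = ker Γ(φ)` along `includeRight` when `Γ(G₁)` is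
`R`-flat and `R → K` injective (the two inclusions above). [cite: EGAIV2, Prop. 2.8.5] [cite: GortzWedhorn2020, (4.15), Definition 4.45 (2) (p. 117)] -/
theorem comap_includeRight_map_algBaseChangeEquiv_ker_eq [Module.Flat R (Alg G₁)] (hK : Function.Injective (algebraMap R K)) :
    ((RingHom.ker (Alg.comap ((Over.pullback (Spec.map (CommRingCat.ofHom (algebraMap R K)))).map φ)).toRingHom).map
        (algBaseChangeEquiv K G₂)).comap (Algebra.TensorProduct.includeRight : Alg G₂ →ₐ[R] K ⊗[R] Alg G₂) =
      RingHom.ker (Alg.comap φ).toRingHom :=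
  le_antisymm (comap_includeRight_map_algBaseChangeEquiv_ker_le K φ hK) (ker_le_comap_includeRight_map_algBaseChangeEquiv_ker K φ)

end GenericImage

/-! ## §2 HEAD: the specialisation of the generic image ideal lies in the special image ideal -/

section Inclusion

/-- **HEAD — IMAGES SPECIALISE (inclusion)**: `spI (ker Γ(φ_K)) ≤ ker Γ(φ_κ)` — the special fibre of the schematic closure in `G₂` of the generic
schematic image `V(ker Γ(φ_K)) ⊂ (G₂)_K` CONTAINS the schematic image of `φ_κ`, for `Γ(G₁)` flat over `R` and `R → K` injective (§1: the closure
ideal is `ker Γ(φ) · (κ ⊗ Γ(G₂))`, killed by `κ ⊗ Γ(φ)`; naturality ★ `algBaseChangeEquiv_comap_pullback_map`).  With (D6-rk) this pins the image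
line of the cell's `QuotQuot₀Law` as the specialisation of the upstairs image line. [cite: EGAIV2, Prop. 2.8.5] [cite: Tate1997FiniteFlatGroupSchemes, (3.7)] -/
theorem spI_ker_comap_pullback_map_le [Module.Flat R (Alg G₁)] (hK : Function.Injective (algebraMap R K)) :
    spI K κ G₂ (RingHom.ker (Alg.comap ((Over.pullback (Spec.map (CommRingCat.ofHom (algebraMap R K)))).map φ)).toRingHom) ≤
      RingHom.ker (Alg.comap ((Over.pullback (Spec.map (CommRingCat.ofHom (algebraMap R κ)))).map φ)).toRingHom := by
  intro x hx
  rw [spI_eq, Ideal.mem_comap] at hx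
  -- the `κ`-span of the closure ideal is killed by `κ ⊗ Γ(φ)`
  have hle : (((RingHom.ker (Alg.comap ((Over.pullback (Spec.map (CommRingCat.ofHom (algebraMap R K)))).map φ)).toRingHom).map
        (algBaseChangeEquiv K G₂)).comap (Algebra.TensorProduct.includeRight : Alg G₂ →ₐ[R] K ⊗[R] Alg G₂)).map
        (Algebra.TensorProduct.includeRight : Alg G₂ →ₐ[R] κ ⊗[R] Alg G₂) ≤
      RingHom.ker (Algebra.TensorProduct.map (AlgHom.id κ κ) (Alg.comap φ)).toRingHom := by
    rw [Ideal.map_le_iff_le_comap]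
    intro a ha
    have ha' := comap_includeRight_map_algBaseChangeEquiv_ker_le K φ hK ha
    rw [RingHom.mem_ker] at ha'
    rw [Ideal.mem_comap, RingHom.mem_ker, Algebra.TensorProduct.includeRight_apply]
    change Algebra.TensorProduct.map (AlgHom.id κ κ) (Alg.comap φ) ((1 : κ) ⊗ₜ[R] a) = 0
    rw [Algebra.TensorProduct.map_tmul, AlgHom.id_apply]
    change (1 : κ) ⊗ₜ[R] ((Alg.comap φ).toRingHom a) = 0
    rw [ha', TensorProduct.tmul_zero]
  have h2 := hle hx
  rw [RingHom.mem_ker] at h2 ⊢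
  change Algebra.TensorProduct.map (AlgHom.id κ κ) (Alg.comap φ) (algBaseChangeEquiv κ G₂ x) = 0 at h2
  change Alg.comap ((Over.pullback (Spec.map (CommRingCat.ofHom (algebraMap R κ)))).map φ) x = 0
  rw [← algBaseChangeEquiv_comap_pullback_map, map_eq_zero_iff _ (algBaseChangeEquiv κ G₁).injective] at h2
  exact h2

end Inclusion

/-! ## §3 Equality under a flat cokernel -/

section FlatCokernel

omit [GrpObj G₁] [GrpObj G₂] [IsAffine G₁.left] [IsAffine G₂.left]
  [IsAffine ((Over.pullback (Spec.map (CommRingCat.ofHom (algebraMap R κ)))).obj G₁).left]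
  [IsAffine ((Over.pullback (Spec.map (CommRingCat.ofHom (algebraMap R κ)))).obj G₂).left]
  [IsAffine ((Over.pullback (Spec.map (CommRingCat.ofHom (algebraMap R K)))).obj G₁).left]
  [IsAffine ((Over.pullback (Spec.map (CommRingCat.ofHom (algebraMap R K)))).obj G₂).left] in
/-- `κ ⊗ Γ(φ)` (Mathlib `Algebra.TensorProduct.map (AlgHom.id κ κ) Γ(φ)`) is `lTensor κ Γ(φ)` on elements. [cite: GortzWedhorn2023, §(27.2) (27.2.1) (pp. 606–607)] -/
theorem lTensor_comap_toLinearMap_apply (z : κ ⊗[R] Alg G₂) :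
    LinearMap.lTensor κ (Alg.comap φ).toLinearMap z = Algebra.TensorProduct.map (AlgHom.id κ κ) (Alg.comap φ) z := by
  induction z using TensorProduct.induction_on with
  | zero => simp only [map_zero]
  | tmul c a => rfl
  | add x y hx hy => simp only [map_add, hx, hy]

/-- **IMAGES SPECIALISE — THE REVERSE INCLUSION UNDER A FLAT COKERNEL**: `ker Γ(φ_κ) ≤ spI (ker Γ(φ_K))` when `Γ(G₁) ⧸ im Γ(φ)` is `R`-flat:
`0 → im Γ(φ) → Γ(G₁) → coker → 0` stays left exact after `κ ⊗_R -` (Mathlib `LinearMap.lTensor_injective_of_exact_of_flat`), and `κ ⊗_R -` is right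
exact on `0 → ker Γ(φ) → Γ(G₂) → im Γ(φ) → 0` (Mathlib `lTensor_exact`, `Ideal.map_includeRight_eq`), so `ker (κ ⊗ Γ(φ)) = ker Γ(φ) · (κ ⊗ Γ(G₂))`,
which lies in the closure ideal by `ker_le_comap_includeRight_map_algBaseChangeEquiv_ker`. [cite: EGAIV2, Prop. 2.8.5] [cite: Tate1997FiniteFlatGroupSchemes, (3.7)] -/
theorem ker_comap_pullback_map_le_spI [Module.Flat R (Alg G₁ ⧸ LinearMap.range (Alg.comap φ).toLinearMap)] :
    RingHom.ker (Alg.comap ((Over.pullback (Spec.map (CommRingCat.ofHom (algebraMap R κ)))).map φ)).toRingHom ≤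
      spI K κ G₂ (RingHom.ker (Alg.comap ((Over.pullback (Spec.map (CommRingCat.ofHom (algebraMap R K)))).map φ)).toRingHom) := by
  intro x hx
  rw [RingHom.mem_ker] at hx
  change Alg.comap ((Over.pullback (Spec.map (CommRingCat.ofHom (algebraMap R κ)))).map φ) x = 0 at hx
  rw [spI_eq, Ideal.mem_comap]
  -- `(κ ⊗ Γ(φ)) (e_κ x) = 0`
  have h1 : LinearMap.lTensor κ (Alg.comap φ).toLinearMap (algBaseChangeEquiv κ G₂ x) = 0 := by
    rw [lTensor_comap_toLinearMap_apply, ← algBaseChangeEquiv_comap_pullback_map, hx, map_zero]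
  -- factor `Γ(φ) = g ∘ π` through its image; `κ ⊗ g` is injective (flat cokernel)
  set f : Alg G₂ →ₗ[R] Alg G₁ := (Alg.comap φ).toLinearMap with hf
  have hfac : f = (LinearMap.range f).subtype ∘ₗ f.rangeRestrict := (LinearMap.subtype_comp_codRestrict _ _ _).symm
  have hinj : Function.Injective (LinearMap.lTensor κ (LinearMap.range f).subtype) :=
    LinearMap.lTensor_injective_of_exact_of_flat (LinearMap.range f).mkQ (Submodule.mkQ_surjective _) (LinearMap.range f).subtype
      (Submodule.injective_subtype _) (LinearMap.exact_subtype_mkQ _) κ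
  have h2 : LinearMap.lTensor κ f.rangeRestrict (algBaseChangeEquiv κ G₂ x) = 0 := by
    apply hinj
    rw [map_zero, ← LinearMap.comp_apply, ← LinearMap.lTensor_comp, ← hfac]
    exact h1
  -- right exactness: `e_κ x` comes from `κ ⊗ ker Γ(φ)`
  have hex : Function.Exact (LinearMap.lTensor κ (LinearMap.ker f.rangeRestrict).subtype) (LinearMap.lTensor κ f.rangeRestrict) :=
    lTensor_exact κ (LinearMap.exact_subtype_ker_map _) (LinearMap.surjective_rangeRestrict _)
  have h3 : algBaseChangeEquiv κ G₂ x ∈ LinearMap.range (LinearMap.lTensor κ (LinearMap.ker f.rangeRestrict).subtype) := by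
    rw [LinearMap.exact_iff] at hex
    rw [← hex]
    exact h2
  rw [LinearMap.ker_rangeRestrict] at h3
  have hker : LinearMap.ker f = (RingHom.ker (Alg.comap φ).toRingHom).restrictScalars R := by
    ext a
    rfl
  rw [hker, ← Ideal.map_includeRight_eq, Submodule.restrictScalars_mem] at h3
  exact Ideal.map_mono (ker_le_comap_includeRight_map_algBaseChangeEquiv_ker K φ) h3

/-- **HEAD — IMAGES SPECIALISE (equality)**: `spI (ker Γ(φ_K)) = ker Γ(φ_κ)` — THE SPECIAL FIBRE OF THE CLOSURE OF THE GENERIC IMAGE IS THE SPECIAL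
IMAGE — for `Γ(G₁)` flat over `R`, `R → K` injective, and `Γ(G₁) ⧸ im Γ(φ)` flat over `R` (e.g. `φ` the `𝔭`-layer of a quotient isogeny with finite
flat kernel over a valuation ring) — §2 and `ker_comap_pullback_map_le_spI`. [cite: EGAIV2, Prop. 2.8.5] [cite: Tate1997FiniteFlatGroupSchemes, (3.7)] -/
theorem spI_ker_comap_pullback_map_eq [Module.Flat R (Alg G₁)] [Module.Flat R (Alg G₁ ⧸ LinearMap.range (Alg.comap φ).toLinearMap)]
    (hK : Function.Injective (algebraMap R K)) :
    spI K κ G₂ (RingHom.ker (Alg.comap ((Over.pullback (Spec.map (CommRingCat.ofHom (algebraMap R K)))).map φ)).toRingHom) =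
      RingHom.ker (Alg.comap ((Over.pullback (Spec.map (CommRingCat.ofHom (algebraMap R κ)))).map φ)).toRingHom :=
  le_antisymm (spI_ker_comap_pullback_map_le K κ φ hK) (ker_comap_pullback_map_le_spI K κ φ)

end FlatCokernel

end AffineGroupScheme

end Literature.AlgebraicGeometry.GroupSchemes

end
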